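import Mathlib.NumberTheory.NumberField.CMField
import Mathlib.NumberTheory.NumberField.InfiniteAdeleRing
import HarnessLib

/-!
# Density of a number field in `∏_{w ∣ ∞} ℂ` and real approximation for the norm-one torus of a CM field

Topic `NumberTheory/NumberFields`; namespace `Literature.NumberTheory.NumberFields`. Everything here is
proved (no named fact).

**Weak approximation at the infinite places** (Mathlib: `NumberField.InfiniteAdeleRing.denseRange_algebraMap`,
the number field `K` is dense in its infinite adèle ring `∏_{v ∣ ∞} K_v`) in the coordinates used by the
tree's CM-field files — complex embeddings `w.embedding : K →+* ℂ` of the infinite places `w`: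

* `denseRange_mixedEmbedding` — Mathlib's mixed embedding `K → ℝ^{r₁} × ℂ^{r₂}` has dense range;
* `denseRange_complexEmbeddings` — `x ↦ (w(x))_{w complex}` has dense range in `∏_{w complex} ℂ`;
* `denseRange_embeddings` — for `K` totally complex, `x ↦ (w(x))_{w ∣ ∞}` has dense range in `∏_{w ∣ ∞} ℂ`;
* `denseRange_embedding_of_isComplex`, `denseRange_of_isTotallyComplex` — a single complex embedding has
  dense image in `ℂ`.

**Real approximation for the norm-one torus `T = U(1)_{L/L⁺}` of a CM field `L`** (`σ = IsCMField.complexConj L`,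
`T(L⁺) = {a ∈ L : a·σ(a) = 1}`; `T` is a connected `L⁺`-torus and `T(L⁺ ⊗ ℝ) = ∏_{w ∣ ∞} U(1)`, the infinite
places of `L` being complex and in bijection with the real places of `L⁺`, Mathlib
`IsCMField.equivInfinitePlace`): `normOne_realApproximation` — every `z ∈ ∏_{w : InfinitePlace L} U(1)` is a
limit of joint images `(w(a))_w`, `a ∈ T(L⁺)`. Proof: weak approximation and `a = x/σ(x)` (given `z`, take
square roots `y_w² = z_w`, so `z_w = y_w / ȳ_w`; approximate `(y_w)_w` by `(w(x))_w`). This is the special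
case `G = T`, `S = V_∞` of the real approximation theorem for connected algebraic groups over number fields
(Platonov–Rapinchuk, *Algebraic Groups and Number Theory* (1994) §7.1 Thm. 7.7 p. 415: "`G(K)` is dense in
`G_∞`"; Getz–Hahn, GTM 300 (2024) Def. 2.9 + Thm. 2.5.2, pp. 42–43; Milne, *Introduction to Shimura
varieties* (2004) Thm. 5.4) — here a theorem, the citation is provenance only. The unitary groups `U(H)` of
hermitian forms of any rank are treated in `Literature/GroupTheory/ArithmeticGroups/UnitaryRealApproximationCM.lean`.

Provenance: `pub-hodgecm` package file `HodgeCM/Literature/RealApproximation.lean` (gen 4, gate run 23), sections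
`NumberFieldDensity` / `Torus`, ported to Mathlib vocabulary (abstract CM field, `IsCMField.complexConj`).

## References

* V. Platonov, A. Rapinchuk, *Algebraic Groups and Number Theory*, Academic Press 1994, §7.1 Thm. 7.7. [PlatonovRapinchuk1994]
* J. R. Getz, H. Hahn, *An Introduction to Automorphic Representations*, GTM 300, Springer 2024, §2.5 Def. 2.9, Thm. 2.5.2. [GetzHahn2024]
-/

noncomputable section

open NumberField NumberField.InfinitePlace Topology
open scoped ComplexConjugate

namespace Literature.NumberTheory.NumberFields

/-! ### Density of a number field in `∏_{w ∣ ∞} ℂ` -/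

section Density

variable (K : Type) [Field K] [NumberField K]

/-- The mixed embedding `K → ℝ^{r₁} × ℂ^{r₂}` has dense range (weak approximation at the infinite places,
Mathlib's `InfiniteAdeleRing.denseRange_algebraMap`, transported along the continuous ring isomorphism
`InfiniteAdeleRing.ringEquiv_mixedSpace`). [folklore] -/
theorem denseRange_mixedEmbedding : DenseRange (mixedEmbedding K) := by
  have hc : Continuous (InfiniteAdeleRing.ringEquiv_mixedSpace K) := by
    refine Continuous.prodMk (continuous_pi fun v => ?_) (continuous_pi fun v => ?_)
    · exact (Completion.isometry_extensionEmbeddingOfIsReal v.2).continuous.comp (continuous_apply _)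
    · exact (Completion.isometry_extensionEmbedding v.1).continuous.comp (continuous_apply _)
  have heq : (mixedEmbedding K : K → mixedEmbedding.mixedSpace K) =
      (InfiniteAdeleRing.ringEquiv_mixedSpace K) ∘ (algebraMap K (InfiniteAdeleRing K)) := by
    funext x
    exact InfiniteAdeleRing.mixedEmbedding_eq_algebraMap_comp K
  rw [heq]
  exact (InfiniteAdeleRing.ringEquiv_mixedSpace K).surjective.denseRange.comp
    (InfiniteAdeleRing.denseRange_algebraMap K) hc

/-- `x ↦ (w(x))_{w complex}` has dense range in `∏_{w complex} ℂ`. [folklore] -/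
theorem denseRange_complexEmbeddings :
    DenseRange (fun x : K => fun w : {w : InfinitePlace K // w.IsComplex} => w.1.embedding x) := by
  have h := (Function.Surjective.denseRange (f := (Prod.snd : mixedEmbedding.mixedSpace K → _))
    Prod.snd_surjective).comp (denseRange_mixedEmbedding K) continuous_snd
  convert h using 1
  funext x
  funext w
  simp [Function.comp]

/-- For a totally complex number field, `x ↦ (w(x))_{w ∣ ∞}` has dense range in `∏_{w : InfinitePlace K} ℂ`
(simultaneous approximation at all archimedean places). [folklore] -/
theorem denseRange_embeddings [IsTotallyComplex K] :
    DenseRange (fun x : K => fun w : InfinitePlace K => w.embedding x) := by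
  let g : ({w : InfinitePlace K // w.IsComplex} → ℂ) → (InfinitePlace K → ℂ) :=
    fun z w => z ⟨w, IsTotallyComplex.isComplex w⟩
  have hg : Continuous g := continuous_pi fun w => continuous_apply _
  have hgs : Function.Surjective g := fun z => ⟨fun w => z w.1, rfl⟩
  exact hgs.denseRange.comp (denseRange_complexEmbeddings K) hg

/-- A complex (non-real) place: its embedding `K → ℂ` has dense image. [folklore] -/
theorem denseRange_embedding_of_isComplex {w : InfinitePlace K} (hw : w.IsComplex) :
    DenseRange (w.embedding : K → ℂ) :=
  (Function.Surjective.denseRange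
    (f := fun z : ({w : InfinitePlace K // w.IsComplex} → ℂ) => z ⟨w, hw⟩) (fun c => ⟨fun _ => c, rfl⟩)).comp
    (denseRange_complexEmbeddings K) (continuous_apply _)

/-- Every complex embedding of a totally complex number field has dense image in `ℂ`. [folklore] -/
theorem denseRange_of_isTotallyComplex [IsTotallyComplex K] (φ : K →+* ℂ) : DenseRange (φ : K → ℂ) := by
  have hw : (InfinitePlace.mk φ).IsComplex := IsTotallyComplex.isComplex _
  have hd := denseRange_embedding_of_isComplex K hw
  rcases embedding_mk_eq φ with h | h
  · rwa [h] at hd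
  · rw [h] at hd
    have hs : Function.Surjective (starRingEnd ℂ : ℂ → ℂ) := fun z => ⟨starRingEnd ℂ z, by simp⟩
    have h2 := hs.denseRange.comp hd Complex.continuous_conj
    convert h2 using 1
    funext x
    simp [Function.comp, ComplexEmbedding.conjugate_coe_eq]

end Density

/-! ### The norm-one torus `U(1)_{L/L⁺}` of a CM field and real approximation for it -/

section NormOne

variable (L : Type) [Field L] [NumberField L] [IsCMField L]

/-- The norm-one elements of the CM field `L` relative to `L/L⁺`: `T(L⁺) = U(1)_{L/L⁺}(L⁺) = {a ∈ L : a·σ(a) = 1}`,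
`σ = IsCMField.complexConj L` (the `L⁺`-points of the norm-one torus `T = ker (N : R_{L/L⁺} 𝔾_m → 𝔾_m)`;
also the unitary group of any hermitian LINE over `L/L⁺`). [folklore] -/
def normOne : Set L := {a : L | a * IsCMField.complexConj L a = 1}

/-- Membership in `normOne`. [folklore] -/
theorem mem_normOne_iff (a : L) : a ∈ normOne L ↔ a * IsCMField.complexConj L a = 1 := Iff.rfl

/-- A norm-one element has absolute value `1` at every complex embedding: `φ(a)·conj φ(a) = φ(a σ(a)) = 1`.
[folklore] -/
theorem conj_mul_embedding_of_mem_normOne (φ : L →+* ℂ) {a : L} (ha : a ∈ normOne L) :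
    starRingEnd ℂ (φ a) * φ a = 1 := by
  rw [mem_normOne_iff] at ha
  rw [mul_comm, ← IsCMField.complexEmbedding_complexConj L φ, ← map_mul, ha, map_one]

/-- A norm-one element has norm `1` at every complex embedding. [folklore] -/
theorem norm_embedding_of_mem_normOne (φ : L →+* ℂ) {a : L} (ha : a ∈ normOne L) : ‖φ a‖ = 1 := by
  have h2 : φ a * starRingEnd ℂ (φ a) = 1 := by rw [mul_comm]; exact conj_mul_embedding_of_mem_normOne L φ ha
  have h3 : ‖φ a‖ ^ 2 = 1 := by
    rw [← Complex.normSq_eq_norm_sq]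
    rw [Complex.mul_conj] at h2
    exact_mod_cast h2
  nlinarith [h3, norm_nonneg (φ a)]

/-- A norm-one element is non-zero at every complex embedding. [folklore] -/
theorem embedding_ne_zero_of_mem_normOne (φ : L →+* ℂ) {a : L} (ha : a ∈ normOne L) : φ a ≠ 0 := by
  intro h0
  have := conj_mul_embedding_of_mem_normOne L φ ha
  rw [h0, mul_zero] at this
  exact zero_ne_one this

/-- `x/σ(x)` is a norm-one element (`x ≠ 0`) — the parametrisation behind Hilbert 90 for `L/L⁺`. [folklore] -/
theorem div_complexConj_mem_normOne {x : L} (hx : x ≠ 0) : x / IsCMField.complexConj L x ∈ normOne L := by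
  have hσ : ∀ y : L, IsCMField.complexConj L (IsCMField.complexConj L y) = y :=
    fun y => IsCMField.complexConj_apply_apply L y
  have hx' : IsCMField.complexConj L x ≠ 0 := by
    intro h0
    apply hx
    have := congrArg (IsCMField.complexConj L) h0
    rwa [hσ, map_zero] at this
  rw [mem_normOne_iff, map_div₀, hσ]
  field_simp

/-- There is an `x ∈ L` with `φ x ∉ ℝ` (a CM field is totally complex). [folklore] -/
theorem exists_im_embedding_ne_zero (φ : L →+* ℂ) : ∃ x : L, (φ x).im ≠ 0 := by
  have h : ¬ ComplexEmbedding.IsReal φ := IsTotallyComplex.complexEmbedding_not_isReal φ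
  rw [ComplexEmbedding.isReal_iff] at h
  by_contra hall
  simp only [not_exists, ne_eq, not_not] at hall
  apply h
  ext x
  rw [ComplexEmbedding.conjugate_coe_eq]
  exact Complex.conj_eq_iff_im.mpr (hall x)

/-- The norm-one torus has infinitely many points; indeed its image under any complex embedding `φ` is infinite:
the elements `a_q = w_q/σ(w_q)`, `w_q = 1 + q·x` (`q ∈ ℕ`, `φ x ∉ ℝ`) have pairwise distinct images
`(1 + q t)/(1 + q t̄)`, `t = φ x`. [folklore] -/
theorem infinite_image_normOne (φ : L →+* ℂ) : (φ '' normOne L).Infinite := by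
  obtain ⟨x, hx⟩ := exists_im_embedding_ne_zero L φ
  set t : ℂ := φ x with ht
  have hw : ∀ q : ℕ, φ (1 + (q : L) * x) = 1 + (q : ℂ) * t := by intro q; simp [ht]
  have hw0 : ∀ q : ℕ, (1 : ℂ) + (q : ℂ) * t ≠ 0 := by
    intro q h0
    have him := congrArg Complex.im h0
    simp only [Complex.add_im, Complex.one_im, Complex.mul_im, Complex.natCast_re, Complex.natCast_im, zero_mul,
      add_zero, zero_add, Complex.zero_im] at him
    rcases mul_eq_zero.mp him with hq | hq
    · have hq' : (q : ℂ) = 0 := by exact_mod_cast hq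
      rw [hq', zero_mul, add_zero] at h0
      exact one_ne_zero h0
    · exact hx hq
  have hwc0 : ∀ q : ℕ, (1 : ℂ) + (q : ℂ) * starRingEnd ℂ t ≠ 0 := by
    intro q h0
    apply hw0 q
    have := congrArg (starRingEnd ℂ) h0
    simpa using this
  have hwL0 : ∀ q : ℕ, (1 : L) + (q : L) * x ≠ 0 := by
    intro q h0
    apply hw0 q
    rw [← hw q, h0, map_zero]
  let f : ℕ → ℂ := fun q => (1 + (q : ℂ) * t) / (1 + (q : ℂ) * starRingEnd ℂ t)
  have hf : ∀ q : ℕ, f q ∈ φ '' normOne L := by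
    intro q
    refine ⟨(1 + (q : L) * x) / IsCMField.complexConj L (1 + (q : L) * x), div_complexConj_mem_normOne L (hwL0 q), ?_⟩
    simp only [f, map_div₀, IsCMField.complexEmbedding_complexConj, hw q, map_add, map_one, map_mul, map_natCast, ← ht]
  have hinj : Function.Injective f := by
    intro q q' hqq
    simp only [f] at hqq
    rw [div_eq_div_iff (hwc0 q) (hwc0 q')] at hqq
    have h1 : ((q : ℂ) - q') * (t - starRingEnd ℂ t) = 0 := by linear_combination hqq
    rcases mul_eq_zero.mp h1 with h | h
    · exact_mod_cast sub_eq_zero.mp h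
    · exfalso
      apply hx
      have : starRingEnd ℂ t = t := (sub_eq_zero.mp h).symm
      exact Complex.conj_eq_iff_im.mp this
  exact Set.infinite_of_injective_forall_mem hinj hf

/-- The norm-one torus of a CM field is infinite. [folklore] -/
theorem infinite_normOne : (normOne L).Infinite := by
  obtain ⟨w₀⟩ := (inferInstance : Nonempty (InfinitePlace L))
  exact Set.Infinite.of_image _ (infinite_image_normOne L w₀.embedding)

/-- The joint archimedean embedding of the torus: `a ↦ (w(a))_{w ∣ ∞}`, `T(L⁺) → T(L⁺ ⊗ ℝ) = ∏_w U(1) ⊂ ∏_w ℂ`.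
[folklore] -/
def normOneEmb (a : normOne L) : InfinitePlace L → ℂ := fun w => w.embedding (a : L)

/-- The coordinates of `normOneEmb a` lie on the unit circle. [folklore] -/
theorem norm_normOneEmb (a : normOne L) (w : InfinitePlace L) : ‖normOneEmb L a w‖ = 1 :=
  norm_embedding_of_mem_normOne L w.embedding a.2

/-- **Real approximation for the norm-one torus `U(1)_{L/L⁺}` of a CM field `L`** (the case `G = U(1)_{L/L⁺}`,
`S = V_∞` of Platonov–Rapinchuk Thm. 7.7 / Getz–Hahn Thm. 2.5.2, PROVED here): `T(L⁺) = {a : a σ(a) = 1}` is dense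
in `T(L⁺ ⊗ ℝ) = ∏_{w ∣ ∞} U(1)` — every family `z = (z_w)_{w : InfinitePlace L}` with `‖z_w‖ = 1` lies in the closure
of the image of `a ↦ (w(a))_w`. Proof: pick `y_w` with `y_w² = z_w` (so `y_w/ȳ_w = z_w`), approximate `(y_w)_w` by
`(w(x))_w` with `x ∈ L` (weak approximation, `denseRange_embeddings`), and take `a = x/σ(x)`.
[cite: PlatonovRapinchuk1994, §7.1 Thm 7.7] -/
theorem normOne_realApproximation (z : InfinitePlace L → ℂ) (hz : ∀ w, ‖z w‖ = 1) :
    z ∈ closure (Set.range (normOneEmb L)) := by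
  classical
  -- square roots: `y_w ^ 2 = z_w`
  have hy : ∀ w : InfinitePlace L, ∃ y : ℂ, y * y = z w := fun w => by
    obtain ⟨y, hy⟩ := IsAlgClosed.exists_eq_mul_self (z w)
    exact ⟨y, hy.symm⟩
  choose y hy using hy
  have hy0 : ∀ w, y w ≠ 0 := by
    intro w h0
    have := hy w
    rw [h0, mul_zero] at this
    have h1 := hz w
    rw [← this, norm_zero] at h1
    exact zero_ne_one h1
  -- the map `q : (u_w) ↦ (u_w / conj u_w)`, continuous at `y`
  let q : (InfinitePlace L → ℂ) → (InfinitePlace L → ℂ) := fun u w => u w / starRingEnd ℂ (u w)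
  have hq : ContinuousAt q y := by
    refine continuousAt_pi.mpr fun w => ?_
    have h1 : ContinuousAt (fun u : InfinitePlace L → ℂ => u w) y := (continuous_apply w).continuousAt
    have h2 : ContinuousAt (fun u : InfinitePlace L → ℂ => starRingEnd ℂ (u w)) y :=
      (Complex.continuous_conj.comp (continuous_apply w)).continuousAt
    exact h1.div h2 (by simpa using hy0 w)
  have hqy : q y = z := by
    funext w
    simp only [q]
    have hne : starRingEnd ℂ (y w) ≠ 0 := by simpa using hy0 w
    rw [div_eq_iff hne]
    have hn : ‖y w‖ = 1 := by
      have : ‖y w‖ * ‖y w‖ = 1 := by rw [← norm_mul, hy w, hz w]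
      nlinarith [norm_nonneg (y w)]
    have hyc : y w * starRingEnd ℂ (y w) = 1 := by
      rw [RCLike.mul_conj, hn]; norm_num
    calc y w = y w * (y w * starRingEnd ℂ (y w)) := by rw [hyc, mul_one]
      _ = z w * starRingEnd ℂ (y w) := by rw [← mul_assoc, hy w]
  -- the dense set: images of `x ∈ L` with all `w(x) ≠ 0`
  let emb : L → (InfinitePlace L → ℂ) := fun x w => w.embedding x
  have hemb : DenseRange emb := denseRange_embeddings L
  let U : Set (InfinitePlace L → ℂ) := {u | ∀ w, u w ≠ 0}
  have hU : IsOpen U := by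
    have : U = ⋂ w, {u : InfinitePlace L → ℂ | u w ≠ 0} := by
      ext u; simp [U]
    rw [this]
    exact isOpen_iInter_of_finite fun w => isOpen_ne.preimage (continuous_apply w)
  have hyU : y ∈ closure (U ∩ Set.range emb) := hemb.open_subset_closure_inter hU hy0
  have hmem : q y ∈ closure (q '' (U ∩ Set.range emb)) :=
    ContinuousWithinAt.mem_closure_image hq.continuousWithinAt hyU
  rw [hqy] at hmem
  refine closure_mono ?_ hmem
  rintro _ ⟨u, ⟨huU, ⟨x, rfl⟩⟩, rfl⟩
  have hx0 : x ≠ 0 := by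
    obtain ⟨w⟩ := (inferInstance : Nonempty (InfinitePlace L))
    intro h0
    exact huU w (by simp [emb, h0])
  refine ⟨⟨x / IsCMField.complexConj L x, div_complexConj_mem_normOne L hx0⟩, ?_⟩
  funext w
  simp only [normOneEmb, q, emb, map_div₀, IsCMField.complexEmbedding_complexConj]

/-- `T(L⁺ ⊗ ℝ) = ∏_{w ∣ ∞} U(1)`: the families `(z_w)_w` of complex numbers of norm `1`, as a subset of `∏_w ℂ`.
[folklore] -/
def unitTorus : Set (InfinitePlace L → ℂ) := {z | ∀ w, ‖z w‖ = 1}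

omit [NumberField L] [IsCMField L] in
/-- Membership in `unitTorus`. [folklore] -/
theorem mem_unitTorus_iff (z : InfinitePlace L → ℂ) : z ∈ unitTorus L ↔ ∀ w, ‖z w‖ = 1 := Iff.rfl

omit [NumberField L] [IsCMField L] in
/-- `unitTorus` is closed in `∏_w ℂ`. [folklore] -/
theorem isClosed_unitTorus : IsClosed (unitTorus L) := by
  have : unitTorus L = ⋂ w, {z : InfinitePlace L → ℂ | ‖z w‖ = 1} := by
    ext z; simp [unitTorus]
  rw [this]
  exact isClosed_iInter fun w => isClosed_eq ((continuous_apply w).norm) continuous_const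

/-- The joint archimedean embedding with values in the torus `∏_w U(1)`. [folklore] -/
def normOneEmbTorus (a : normOne L) : unitTorus L := ⟨normOneEmb L a, norm_normOneEmb L a⟩

/-- `DenseRange` form: the image of `T(L⁺)` is dense in the compact torus `∏_{w ∣ ∞} U(1)`.
[cite: PlatonovRapinchuk1994, §7.1 Thm 7.7] -/
theorem denseRange_normOneEmbTorus : DenseRange (normOneEmbTorus L) := by
  rw [DenseRange, Subtype.dense_iff]
  rintro z hz
  refine closure_mono ?_ (normOne_realApproximation L z hz)
  rintro _ ⟨a, rfl⟩
  exact ⟨normOneEmbTorus L a, ⟨a, rfl⟩, rfl⟩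

end NormOne

end Literature.NumberTheory.NumberFields

end
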